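import Literature.MathematicalPhysics.QuantumFieldTheory.Balaban1983to89.B5Eq117TorusCarriers
import Literature.MathematicalPhysics.QuantumFieldTheory.Balaban1983to89.B5Eq112TorusBridge
import Literature.MathematicalPhysics.QuantumFieldTheory.Balaban1983to89.B5Eq117FibreVolume

/-!
# `Balaban1983to89.B5Eq117TorusBridge` — T. Bałaban, *Propagators and renormalization transformations for lattice gauge
theories. I*, Commun. Math. Phys. **95** (1984) 17–40 [Balaban1984PropagatorsI], (1.17) p. 20: «((ST)^k e^{−S})(B) = z^{(k)} ∫dA δ(B − Q_kA)
δ_Ax(Q_{k−1}A)·…·δ_Ax(A) e^{−S^η(A)}» — the KNITTING of its two formalizations: seat p38's V1 `B5Eq117CompositionV1.multiRT`/`rtPow` IS,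
up to one positive constant, the B5 owner's tower `B5SectBStatements.rt17`/`iterST`; whence [BalabanImbrieJaffe1985] (4.1.4) `Z_{k,Ax}`
(p09's `torusZax`) = c · `rt17` (file 2 of 2; carriers/dictionaries/slices = `B5Eq117TorusCarriers`)

statement-level skeleton of published theorems with citation tags; proofs where landed; nothing here is a claim about the Yang–Mills mass gap

PDF held: `paper:balaban1984-cmp95-propagators-rt-i` (journal page = PDF page + 16); pp. 20–21, 25–26 [PDF 4–5, 9–10] read from the
materialised text `~/.lit/texts/paper-balaban1984-cmp95-propagators-rt-i/p0004.txt … p0010.txt`.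

PRINT, verbatim.  p. 20 [PDF 4]: *"((ST)^k e^{−S})(B) = z^{(k)} ∫dA δ(B − Q_kA) δ_Ax(Q_{k−1}A)·…·δ_Ax(A) e^{−S^η(A)}, (1.17) where z^{(k)}
is a numerical factor arising from scaling transformations … The δ-function δ(B − Q_kA) is invariant with respect to gauge
transformations λ satisfying Q′_kλ = 0 and we can look at the integral (1.17) as obtained by removing this gauge freedom by the help
of the δ-functions δ_Ax."*  p. 21 [PDF 5]: *"The restrictions on the gauge transformations given by the δ-functions above are chosen
in such a way that all the expressions in the integral (1.17) with the exception of gauge fixing terms δ_Ax are invariant."*  p. 26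
[PDF 10]: *"We may introduce this gauge from the beginning using the equation ∫dλ δ(Q′_kλ)∣det(Δ↾_{N(Q′_k)})∣δ_R(∂*A − Δλ) = 1. (1.46)"*.

CITATION HEADER (lean-in-tree rule) — WHAT IS REPRODUCED.  SKELETON rows `B5.Eq1.17` (two PROVED formalizations: r02's `eq117_holds`
on the tower p245722, p38's V1 `eq117`/`eq117_curlAction` p248231/p248412) and `C1.Eq4.1.3-4.1.5` (p09 `BIJ85AxialMinimizer413.torusZax`,
= p38's `multiRT` by `B5Eq117FibreVolume.multiRT_exp_eq_torusZax`): FILE 2 of the tower knitting (method of `B5Eq112TorusBridge`, now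
over `k` levels).  V1: `multiRT k ρ B = B9Eq3166.subInt (kerBasisIter P k) (ρ (faceFieldIter k B + ·))`, the Lebesgue integral over the
fibre `{A : Q_kA = B, δ_{k,Ax}(A)}` (CENTRED trees at every level), `rtPow k` = `(ST)^k`; tower: `rt17 L M k = deltaInt (Qk L M k)
(AxAll L M k) e^{−S^η}` (CORNER trees, convention (1.40)), `iterST k` = `(ST)^k`.
WHAT IS PROVED (kernel, no `sorry`, standard axioms; standing range `k ≤ m + K`):
* §3 `multiRT_eq_deltaInt` — the V1 integral IS the tower-side δ-integral of the transported density `ρ∘tV⁻¹` over the fibre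
  `{Q_kA′ = tB B} ∩ axTK` (ambient reindexing `B5Eq112TorusBridge.subInt_reindex` + p38's `B5Eq117FibreVolume.subInt_eq_integral_submodule`);
* §4 **THE (1.17) BRIDGE** `multiRT_eq_const_mul_deltaInt`: ONE `c > 0` (a function of `P`, `k`) with `multiRT k ρ B =
  c·∫dA′ δ(tB B − Q_kA′) δ_{AxAll}(A′) ρ(tV⁻¹A′)` for EVERY density `ρ` invariant under the gauge transformations (1.4) of the finest
  lattice — `B5Eq147Landau.deltaInt_exchange` between the two complete gauge fixings `axTK` (V1, centred) and `AxAll k` (corner) of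
  `∂N(Q′_k)` (`B5Eq117TorusCarriers.isCompl_axTK_orbit`, `B5Eq147Landau.isCompl_axAll_orbit`, `orbit_le_ker`); whence
  **`multiRT_eq_const_mul_rt17`** (`e^{−S^η}`: `multiRT k e^{−½Σ_p η^d|(∂^{L^k}A)(p)|²} B = c·rt17 L Mk k (tB B)`),
  **`rtPow_eq_const_mul_iterST`** (d ≥ 2: p38's `(ST)^k` = c′ · r02's `(ST)^k`, via the two proved (1.17)s), and
  **`torusZax_eq_const_mul_rt17`** ([BalabanImbrieJaffe1985] (4.1.4): `Z_{k,Ax}(faceFieldIter k B) = c·rt17 L Mk k (tB B)`).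
HONEST SCOPE.  (i) The V1 and tower files fix DIFFERENT block trees at every level, so for densities that are NOT gauge invariant the
two (1.17)-integrals differ and nothing is claimed; the bridge is the printed gauge-independence (p. 20/21, (1.46)).  (ii) The constants
are existential slice Jacobians in the flat normalisations (convention (1.40) on both sides), not evaluated — as «z^{(k)} is a numerical
factor» in print.  (iii) U = 1, real fields, every `d ≥ 1` (`rtPow_eq_const_mul_iterST` needs `d ≥ 2` only because r02's `eq117_holds`
does), odd `L > 1`.  Theorems only; no new definitions, no `def … : Prop`.

Unit `lit-balaban-p16` gen 3 (Phase-2 proof seat p16; literature-prover-lit-balaban-p16-g3-0), HOME `run/shared/lean/pub/lit-balaban/`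
(STATUS: `lit-balaban-p16/STATUS.md`), 2026-08-21.
-/

open scoped BigOperators Matrix

namespace Literature.MathematicalPhysics.QuantumFieldTheory.Balaban1983to89

namespace B5Eq117TorusBridge

open LatticeFieldCalculus B5SectBStatements B5Eq112TorusCarriers B5Eq117TorusCarriers
open B5Prop11Plancherel (Tor fine)
open B5Eq112RenormTransf
open B9Eq3166 (subInt)
open B5Eq117CompositionV1 (multiRT rtPow kerBasisIter kerDimIter isBasisOf_kerBasisIter faceFieldIter bondAvgIter_faceFieldIter
  deltaAx_faceFieldIter eq117_curlAction)
open Literature.MathematicalPhysics.QuantumFieldTheory.BalabanImbrieJaffe1984to88.BIJ85AxialPropagator411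
  (deltaAx constraint411 mem_constraint411)
open Literature.MathematicalPhysics.QuantumFieldTheory.BalabanImbrieJaffe1984to88.BIJ85GaugeFunction5113 (grad_smul grad_mul)

noncomputable section

variable {P : Params} {k : ℕ}

/-! ## §3  The right-hand side of (1.17) on V1 read as a δ-integral (convention (1.40)) on the tower -/

/-- **the V1 integral «∫dA δ(B − Q_kA)δ_Ax(Q_{k−1}A)⋯δ_Ax(A)ρ(A)» read on the tower**: p38's `multiRT k ρ B` IS the δ-integral
`deltaInt` (flat measure of the constraint subspace, (1.40)) of the transported density `ρ∘tV⁻¹` over the fibre `{Q_kA′ = tB B} ∩ axTK`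
— same normalisation (`√det(Gram)`·Lebesgue = subspace volume, p38's `B5Eq117FibreVolume.subInt_eq_integral_submodule`, after the ambient
reindexing `B5Eq112TorusBridge.subInt_reindex`), base point the transported `faceFieldIter k B`. [cite: Balaban1984PropagatorsI, (1.17) p.20] -/
theorem multiRT_eq_deltaInt (hk : k ≤ P.m + P.K) (ρ : VecField P 0 ℝ → ℝ) (B : VecField P k ℝ) :
    multiRT k ρ B = deltaInt (Qk P.L (Mk P k) k) (axTK hk) (fun A' => ρ ((tV hk).symm A')) (tB B) := by
  set σ := (eBondK hk).symm with hσ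
  set N' : Matrix (Tor (towerM P.L (Mk P k) k) × Fin P.d) (Fin (kerDimIter P k)) ℝ := (kerBasisIter P k).submatrix σ id
    with hN'
  have hmv : ∀ z, N' *ᵥ z = (kerBasisIter P k *ᵥ z) ∘ σ := fun z => rfl
  have hN'inj : Function.Injective N'.mulVec := by
    intro z w h
    apply (isBasisOf_kerBasisIter (P := P) k).inj
    have h' : (kerBasisIter P k *ᵥ z) ∘ σ = (kerBasisIter P k *ᵥ w) ∘ σ := by rw [← hmv, ← hmv]; exact h
    funext b
    have := congrFun h' (σ.symm b)
    simpa only [Function.comp_apply, Equiv.apply_symm_apply] using this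
  have hK : ∀ x : Fld (towerM P.L (Mk P k) k),
      x ∈ dirSpace (Qk P.L (Mk P k) k) (axTK hk) ↔ WithLp.ofLp x ∈ Set.range N'.mulVec := by
    intro x
    have hx : WithLp.ofLp x ∘ ⇑σ.symm = (tV hk).symm x := rfl
    rw [mem_dirSpace_iff, mem_axTK_iff, Set.mem_range]
    have e1 : Qk P.L (Mk P k) k x = 0 ↔ bondAvgIter k ((tV hk).symm x) = 0 := by
      conv_lhs => rw [← (tV hk).apply_symm_apply x, Qk_tV]
      exact (tB (P := P) (k := k)).map_eq_zero_iff
    rw [e1]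
    constructor
    · rintro ⟨hQ, hAx⟩
      have hmem : (tV hk).symm x ∈ ((constraint411 k : Submodule ℝ (VecField P 0 ℝ)) : Set (VecField P 0 ℝ)) := ⟨hQ, hAx⟩
      obtain ⟨z, hz⟩ := ((isBasisOf_kerBasisIter (P := P) k).mem_iff _).1 hmem
      refine ⟨z, ?_⟩
      rw [hmv, hz, ← hx, Function.comp_assoc, Equiv.symm_comp_self, Function.comp_id]
    · rintro ⟨z, hz⟩
      have hz' : kerBasisIter P k *ᵥ z = (tV hk).symm x := by
        rw [← hx, ← hz, hmv, Function.comp_assoc, Equiv.self_comp_symm, Function.comp_id]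
      have hmem : (tV hk).symm x ∈ ((constraint411 k : Submodule ℝ (VecField P 0 ℝ)) : Set (VecField P 0 ℝ)) :=
        ((isBasisOf_kerBasisIter (P := P) k).mem_iff _).2 ⟨z, hz'⟩
      exact ⟨hmem.1, hmem.2⟩
  have hA₀ : tV hk (faceFieldIter k B) ∈ fibre (Qk P.L (Mk P k) k) (axTK hk) (tB B) := by
    refine ⟨by rw [Qk_tV, bondAvgIter_faceFieldIter hk], (mem_axTK_iff hk _).2 ?_⟩
    rw [LinearEquiv.symm_apply_apply]
    exact deltaAx_faceFieldIter hk B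
  rw [deltaInt_eq _ hA₀, multiRT, B5Eq112TorusBridge.subInt_reindex σ,
    ← B5Eq117FibreVolume.subInt_eq_integral_submodule N' hN'inj _ hK
      (fun x => ρ ((tV hk).symm (tV hk (faceFieldIter k B) + x)))]
  congr 1
  funext v
  simp only [map_add, LinearEquiv.symm_apply_apply]
  rfl

/-! ## §4  THE (1.17) BRIDGE: p38's V1 tower = c · the B5 owner's tower, for every gauge-invariant density -/

/-- adding a residual-orbit direction `∂^{L^k}λ` on the tower is, after pull-back, the V1 gauge transformation (1.4)
`A ↦ A − ∂^{c₀}(−(L^k/c₀)·λ)`. [cite: Balaban1984PropagatorsI, (1.4) p.18, (1.20) p.20] -/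
theorem tV_symm_add_Dg (hk : k ≤ P.m + P.K) {c₀ : ℝ} (hc₀ : c₀ ≠ 0) (A' : Fld (towerM P.L (Mk P k) k))
    (l : Scl (towerM P.L (Mk P k) k)) :
    (tV hk).symm (A' + B5HierGaugeTorus.Dg P.L (Mk P k) k l)
      = gaugeShift c₀ (-(((P.L : ℝ) ^ k / c₀) • (tS hk).symm l)) ((tV hk).symm A') := by
  rw [map_add, Dg_apply_eq, tV_symm_Dgrad]
  funext b
  simp only [Pi.add_apply, gaugeShift, grad, Pi.neg_apply, Pi.smul_apply, smul_eq_mul]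
  field_simp
  ring

/-- **THE (1.17) BRIDGE** p. 20 [PDF 4]: there is ONE constant `c > 0` (a function of `P`, `k`: the Jacobian of the change from the centred
to the corner hierarchical axial gauge, cf. (1.46)) such that for every lattice factor `c₀ ≠ 0`, every density `ρ` of the finest V1 field
invariant under the gauge transformations (1.4) `A ↦ A − ∂^{c₀}λ`, and every unit-lattice field `B`:
`multiRT k ρ B = c · deltaInt (Qk L Mk k) (AxAll L Mk k) (ρ∘tV⁻¹) (tB B)` — p38's V1 reading of the right-hand side of (1.17) equals the
B5 owner's, up to `c`.  Proof = §3 + `B5Eq147Landau.deltaInt_exchange` between the slices `axTK` and `AxAll k` of `∂N(Q′_k) ≤ N(Q_k)`.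
[cite: Balaban1984PropagatorsI, (1.17) p.20, (1.46) p.26] -/
theorem multiRT_eq_const_mul_deltaInt (hk : k ≤ P.m + P.K) :
    ∃ c : ℝ, 0 < c ∧ ∀ (c₀ : ℝ), c₀ ≠ 0 → ∀ ρ : VecField P 0 ℝ → ℝ,
      (∀ (lam : SiteField P 0 ℝ) (A : VecField P 0 ℝ), ρ (gaugeShift c₀ lam A) = ρ A) →
      ∀ B : VecField P k ℝ,
        multiRT k ρ B
          = c * deltaInt (Qk P.L (Mk P k) k) (AxAll P.L (Mk P k) k) (fun A' => ρ ((tV hk).symm A')) (tB B) := by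
  obtain ⟨c, hc, h⟩ := B5Eq147Landau.deltaInt_exchange (Qk P.L (Mk P k) k) (B5Eq147Landau.orbit_le_ker P.L (Mk P k) k)
    (isCompl_axTK_orbit hk) (B5Eq147Landau.isCompl_axAll_orbit P.L (Mk P k) k)
  refine ⟨c, hc, fun c₀ hc₀ ρ hρ B => ?_⟩
  rw [multiRT_eq_deltaInt hk ρ B]
  refine h _ (fun A' g hg => ?_) (tB B)
  obtain ⟨l, -, rfl⟩ := (B5Eq147Landau.mem_orbit_iff _ _ k g).1 hg
  simp only [tV_symm_add_Dg hk hc₀, hρ]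

/-- **(1.17), right-hand sides**: for the printed density `e^{−S^η(A)}` (`S^η = ½Σ_p η^d|(∂^{η⁻¹}A)(p)|²`, `η = L^{−k}`; V1 `curlAction (η^d)
(L^k)` = tower `actionEta k` by `actionEta_tV`), `multiRT k e^{−S^η} B = c · rt17 L Mk k (tB B)` with ONE `c > 0` for all `B`.
[cite: Balaban1984PropagatorsI, (1.17) p.20] -/
theorem multiRT_eq_const_mul_rt17 (hk : k ≤ P.m + P.K) :
    ∃ c : ℝ, 0 < c ∧ ∀ B : VecField P k ℝ,
      multiRT k (fun A => Real.exp (-curlAction (eta P.L k ^ P.d) ((P.L : ℝ) ^ k) A)) B = c * rt17 P.L (Mk P k) k (tB B) := by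
  obtain ⟨c, hc, h⟩ := multiRT_eq_const_mul_deltaInt (P := P) (k := k) hk
  refine ⟨c, hc, fun B => ?_⟩
  rw [h 1 one_ne_zero _ (fun lam A => by rw [curlAction_gaugeShift]) B, rt17]
  congr 2
  funext A'
  rw [← actionEta_tV hk, LinearEquiv.apply_symm_apply]

/-- **(1.17), left-hand sides (d ≥ 2)**: the two `(ST)^k e^{−S}` agree up to a constant — p38's `rtPow k e^{−S^η}` (V1, `(ST)^k` as the
`k`-fold composition of (1.12)) `= c′ · iterST L Mk k e^{−S} (tB B)` (r02's `(ST)^k` with the rescaling `S` of (1.5)), from the two PROVED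
(1.17)s `B5Eq117CompositionV1.eq117_curlAction` (V1) and `B5Eq114Gauss.eq117_holds` (tower, `d ≥ 2`) and `multiRT_eq_const_mul_rt17`.
[cite: Balaban1984PropagatorsI, (1.17) p.20] -/
theorem rtPow_eq_const_mul_iterST (hd : 2 ≤ P.d) (hk : k ≤ P.m + P.K) :
    ∃ c : ℝ, 0 < c ∧ ∀ B : VecField P k ℝ,
      rtPow k (fun A => Real.exp (-curlAction (eta P.L k ^ P.d) ((P.L : ℝ) ^ k) A)) B
        = c * iterST P.L (Mk P k) k (fun A => Real.exp (-action1 A)) (tB B) := by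
  have hL : (0 : ℝ) < P.L := Nat.cast_pos.2 P.L_pos
  have hw : 0 < eta P.L k ^ P.d := by unfold eta; exact pow_pos (inv_pos.2 (pow_pos hL k)) _
  have hc : ((P.L : ℝ) ^ k) ≠ 0 := pow_ne_zero _ hL.ne'
  obtain ⟨z₁, hz₁, h₁⟩ := eq117_curlAction (P := P) hk hw hc
  obtain ⟨c, hcpos, h₂⟩ := multiRT_eq_const_mul_rt17 (P := P) (k := k) hk
  obtain ⟨z₂, hz₂, h₃⟩ := B5Eq114Gauss.eq117_holds P.L (Mk P k) hd k
  refine ⟨z₁ * c / z₂, div_pos (mul_pos hz₁ hcpos) hz₂, fun B => ?_⟩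
  rw [h₁ B, h₂ B, h₃ (tB B)]
  field_simp

/-- **[BalabanImbrieJaffe1985] (4.1.4) `Z_{k,Ax}(B) = ∫dA δ(Q_kA − B)δ_{k,Ax}(A)exp(−½‖∂A‖²)` = c · B5 (1.17) on the tower**: p09's
`BIJ85AxialMinimizer413.torusZax` (weight `η^d`, factor `L^k`, at the V1 representative `faceFieldIter k B`) equals `c · rt17 L Mk k (tB B)`
(through p38's `B5Eq117FibreVolume.multiRT_exp_eq_torusZax`). [cite: BalabanImbrieJaffe1985, (4.1.4) p.310] -/
theorem torusZax_eq_const_mul_rt17 (hk : k ≤ P.m + P.K) :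
    ∃ c : ℝ, 0 < c ∧ ∀ B : VecField P k ℝ,
      Literature.MathematicalPhysics.QuantumFieldTheory.BalabanImbrieJaffe1984to88.BIJ85AxialMinimizer413.torusZax
          (eta P.L k ^ P.d) ((P.L : ℝ) ^ k) k (faceFieldIter k B)
        = c * rt17 P.L (Mk P k) k (tB B) := by
  obtain ⟨c, hc, h⟩ := multiRT_eq_const_mul_rt17 (P := P) (k := k) hk
  refine ⟨c, hc, fun B => ?_⟩
  have hL : (0 : ℝ) < P.L := Nat.cast_pos.2 P.L_pos
  have hw : 0 ≤ eta P.L k ^ P.d := by unfold eta; exact pow_nonneg (inv_nonneg.2 (pow_nonneg hL.le k)) _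
  rw [← h B, B5Eq117FibreVolume.multiRT_exp_eq_torusZax hw]

end

end B5Eq117TorusBridge

end Literature.MathematicalPhysics.QuantumFieldTheory.Balaban1983to89
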